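import Literature.AlgebraicGeometry.Frobenioids.DivisorMonoidCategoryTheoreticity
import HarnessLib

/-!
# Frobenioids I, Corollary 4.11 (iii) — descent of `Ψ^Φ` from `C` to the base category `D`

Mochizuki, *The geometry of Frobenioids I: the general theory*, Kyushu J. Math. **62** (2008)
293–400, kurims text proof of Cor. 4.11 (iii) p. 94: "assertion (iii) follows formally from assertion
(ii); Theorem 4.9 [cf. also Definition 1.3, (i), (a), (b); the technique of using the equivalence of
categories '`D^* ⥲ D`' applied in Proposition 2.2, (ii)]" [cite: MochizukiFrdI2008, Cor. 4.11 (iii) p.94].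

PROOF-ONLY companion of `DivisorMonoidCategoryTheoreticity.lean` (seat abc-iut-L1-t3), generic over the
operations `S_i : PreFrobenioidData C_i D_i`. Theorem 4.9 is typed there as an isomorphism of functors
`Ψ^Φ : Φ₁ ⥲ Φ₂` lying over `Ψ` with the `Φ_i` regarded as functors ON `C_i`
(`DivisorMonoidIsoOver S₁ S₂ Ψ`: components `Φ₁(Base A) ≃ Φ₂(Base Ψ A)`, natural along arrows of `C₁`);
Cor. 4.11 (iii) wants it ON `D_i`, lying over the `Ψ^Base` of Cor. 4.11 (ii)
(`DivisorMonoidIsoOverBase S₁ S₂ ΨBase`: components `Φ₁(X) ≃ Φ₂(Ψ^Base X)`, natural along arrows of `D₁`).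
This file proves the descent:

* `pull_eq_of_pull_eq_of_comp_eq_id`, `comp_base_map_eq`, `exists_pull_mulEquiv`: bookkeeping;
* `DivisorMonoidIsoOver.iso_pull_iso`: INDEPENDENCE — the components of `Ψ^Φ` at two objects `A₀`, `A`
  with isomorphic bases `g : Base A₀ ≅ Base A` agree after transport along `g` and
  `η_{A₀} ∘ Ψ^Base(g) ∘ η_A⁻¹` (uses Def. 1.3 (i)(b): `g` is `Base(ψ) ∘ Base(φ)⁻¹` for base-isomorphisms
  `φ : X → A₀`, `ψ : X → A`);
* `DivisorMonoidIsoOver.exists_overBase`: given `Ψ^Base` with `η : Base₂ ∘ Ψ ≅ Ψ^Base ∘ Base₁` and the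
  Frobenioid-type hypotheses Def. 1.3 (i)(a) (every `X ∈ Ob(D₁)` is isomorphic to a `Base A`), (i)(b), and
  (i)(c) in the form "every `f : Y → Base A` is, up to an isomorphism of `Y`, the base of an arrow
  `A' → A`", there is `Ψ^Φ` ON `D₁` lying over `Ψ^Base`, agreeing with the given `Ψ^Φ` at every `Base A`
  (transported along `η_A`).

No statement of the paper is strengthened; nothing here is specific to the abc programme.
-/

namespace Literature.AlgebraicGeometry.Frobenioids

open CategoryTheory Opposite

universe w w₁ w₂ v v' v₁ v₁' v₂ v₂' u u' u₁ u₁' u₂ u₂'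

namespace PreFrobenioidData

section OneFrobenioid

variable {C : Type u} [Category.{v} C] {D : Type u'} [Category.{v'} D] (S : PreFrobenioidData.{w} C D)

/-- Bookkeeping: if `a^* u = b^* v` and `m ∘ … ∘ a = id` (`m ≫ a = 𝟙`), then `u = (m ≫ b)^* v`.
[cite: MochizukiFrdI2008, Def. 1.1 (iv) p.20] -/
theorem pull_eq_of_pull_eq_of_comp_eq_id {X Y Z : D} (a : Y ⟶ X) (b : Y ⟶ Z) (m : X ⟶ Y)
    (hm : m ≫ a = 𝟙 X) (u : S.Mon X) (v : S.Mon Z) (H : S.pull a u = S.pull b v) :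
    u = S.pull (m ≫ b) v := by
  calc u = S.pull (𝟙 X) u := (S.pull_id X u).symm
    _ = S.pull (m ≫ a) u := by rw [hm]
    _ = S.pull m (S.pull a u) := S.pull_comp _ _ _
    _ = S.pull m (S.pull b v) := by rw [H]
    _ = S.pull (m ≫ b) v := (S.pull_comp _ _ _).symm

/-- Pull-back along an isomorphism `i : Y ≅ X` of `D` is an isomorphism of monoids `Φ(X) ≃ Φ(Y)`.
[cite: MochizukiFrdI2008, Def. 1.1 (iv) p.20] -/
theorem exists_pull_mulEquiv {X Y : D} (i : Y ≅ X) :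
    ∃ m : S.Mon X ≃* S.Mon Y, ∀ x, m x = S.pull i.hom x := by
  refine ⟨MonoidHom.toMulEquiv (S.pull i.hom) (S.pull i.inv) ?_ ?_, fun x => rfl⟩
  · ext x
    show S.pull i.inv (S.pull i.hom x) = x
    rw [← S.pull_comp, i.inv_hom_id, S.pull_id]
  · ext y
    show S.pull i.hom (S.pull i.inv y) = y
    rw [← S.pull_comp, i.hom_inv_id, S.pull_id]

end OneFrobenioid

section TwoFrobenioids

variable {C₁ : Type u₁} [Category.{v₁} C₁] {D₁ : Type u₁'} [Category.{v₁'} D₁]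
variable {C₂ : Type u₂} [Category.{v₂} C₂] {D₂ : Type u₂'} [Category.{v₂'} D₂]
variable {S₁ : PreFrobenioidData.{w₁} C₁ D₁} {S₂ : PreFrobenioidData.{w₂} C₂ D₂} {Ψ : C₁ ≌ C₂}

/-- Along a `1`-commutation `η : Base₂ ∘ Ψ ≅ Ψ^Base ∘ Base₁`, `Base₂(Ψ φ) = η_A⁻¹ ∘ Ψ^Base(Base₁ φ) ∘ η_X`
(pointwise form, all objects written as `Base₂ (Ψ X)`, `Ψ^Base (Base₁ X)`).
[cite: MochizukiFrdI2008, Cor. 4.11 (ii) p.91] -/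
theorem comp_base_map_eq (ΨBase : D₁ ⥤ D₂) (η : Ψ.functor ⋙ S₂.base ≅ S₁.base ⋙ ΨBase)
    (θ : ∀ B : C₁, S₂.base.obj (Ψ.functor.obj B) ≅ ΨBase.obj (S₁.base.obj B)) (hθ : ∀ B, θ B = η.app B)
    {X A : C₁} (φ : X ⟶ A) :
    S₂.base.map (Ψ.functor.map φ) = (θ X).hom ≫ ΨBase.map (S₁.base.map φ) ≫ (θ A).inv := by
  have h : S₂.base.map (Ψ.functor.map φ) ≫ (θ A).hom = (θ X).hom ≫ ΨBase.map (S₁.base.map φ) := by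
    rw [hθ, hθ]
    exact η.hom.naturality φ
  rw [← Category.assoc, ← h, Category.assoc, Iso.hom_inv_id, Category.comp_id]

namespace DivisorMonoidIsoOver

variable (E : DivisorMonoidIsoOver S₁ S₂ Ψ) (ΨBase : D₁ ⥤ D₂) (η : Ψ.functor ⋙ S₂.base ≅ S₁.base ⋙ ΨBase)

/-- INDEPENDENCE of `Ψ^Φ` from the object over a given base (the "`D^* ⥲ D`" technique, FrdI proof of
Cor. 4.11 (iii) p. 94 with Def. 1.3 (i)(b)): if every base-isomorphism `g : Base A₀ ≅ Base A` is of the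
form `Base(ψ) ∘ Base(φ)⁻¹` for arrows `φ : X → A₀`, `ψ : X → A` with `Base(φ)` invertible, then
`Ψ^Φ_{A₀} (g^* x) = (η_{A₀} ≫ Ψ^Base g ≫ η_A⁻¹)^* (Ψ^Φ_A x)`. [cite: MochizukiFrdI2008, Cor. 4.11 (iii) p.94] -/
theorem iso_pull_iso
    (hconn : ∀ (A B : C₁) (g : S₁.base.obj A ≅ S₁.base.obj B), ∃ (X : C₁) (φ : X ⟶ A) (ψ : X ⟶ B),
      IsIso (S₁.base.map φ) ∧ S₁.base.map φ ≫ g.hom = S₁.base.map ψ)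
    {A₀ A : C₁} (g : S₁.base.obj A₀ ≅ S₁.base.obj A) (x : S₁.Mon (S₁.base.obj A)) :
    E.iso A₀ (S₁.pull g.hom x) =
      S₂.pull ((η.app A₀).hom ≫ ΨBase.map g.hom ≫ (η.app A).inv) (E.iso A x) := by
  -- pointwise form of `η`
  let θ : ∀ B : C₁, S₂.base.obj (Ψ.functor.obj B) ≅ ΨBase.obj (S₁.base.obj B) := fun B => η.app B
  have hc := fun {B B' : C₁} (χ : B ⟶ B') => comp_base_map_eq ΨBase η θ (fun _ => rfl) χ
  show E.iso A₀ (S₁.pull g.hom x) = S₂.pull ((θ A₀).hom ≫ ΨBase.map g.hom ≫ (θ A).inv) (E.iso A x)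
  obtain ⟨X, φ, ψ, hφ, hg⟩ := hconn A₀ A g
  -- the two naturality squares of `Ψ^Φ`, along `φ` and along `ψ`
  have h1 := E.natural φ (S₁.pull g.hom x)
  rw [← S₁.pull_comp, hg, E.natural ψ x] at h1
  -- `Base₂(Ψ φ)` is invertible
  haveI : IsIso (S₂.base.map (Ψ.functor.map φ)) := by rw [hc φ]; infer_instance
  have h2 := S₂.pull_eq_of_pull_eq_of_comp_eq_id _ _ _ (IsIso.inv_hom_id (S₂.base.map (Ψ.functor.map φ)))
    _ _ h1.symm
  have hk : inv (S₂.base.map (Ψ.functor.map φ)) ≫ S₂.base.map (Ψ.functor.map ψ) =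
      (θ A₀).hom ≫ ΨBase.map g.hom ≫ (θ A).inv := by
    rw [IsIso.inv_comp_eq, hc ψ, hc φ, ← hg]
    simp only [Category.assoc, Iso.inv_hom_id_assoc, Functor.map_comp]
  rw [h2, hk]

/-- DESCENT of `Ψ^Φ` from `C` to `D` (FrdI proof of Cor. 4.11 (iii) p. 94: "(iii) follows formally from
(ii); Theorem 4.9 [cf. also Definition 1.3, (i), (a), (b); the technique of … '`D^* ⥲ D`']"): given
`Ψ^Base : D₁ → D₂` with `η : Base₂ ∘ Ψ ≅ Ψ^Base ∘ Base₁`, and assuming of `C₁ → D₁` that (a) every object of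
`D₁` is isomorphic to some `Base A`, (b) every base-isomorphism `Base A₀ ≅ Base A` is `Base(ψ) ∘ Base(φ)⁻¹`
with `Base(φ)` invertible, (c) every `f : Y → Base A` is, up to an isomorphism of `Y`, the base of an
arrow `A' → A` (Def. 1.3 (i)(a)(b)(c)), an isomorphism of functors `Ψ^Φ : Φ₁ ⥲ Φ₂` lying over `Ψ` on the
`C_i` descends to one ON THE BASE CATEGORIES lying over `Ψ^Base`, which at each `Base A` is `Ψ^Φ_A`
followed by transport along `η_A`. [cite: MochizukiFrdI2008, Cor. 4.11 (iii) p.94] -/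
theorem exists_overBase
    (hbase : ∀ X : D₁, ∃ A : C₁, Nonempty (S₁.base.obj A ≅ X))
    (hconn : ∀ (A B : C₁) (g : S₁.base.obj A ≅ S₁.base.obj B), ∃ (X : C₁) (φ : X ⟶ A) (ψ : X ⟶ B),
      IsIso (S₁.base.map φ) ∧ S₁.base.map φ ≫ g.hom = S₁.base.map ψ)
    (hpb : ∀ (A : C₁) {Y : D₁} (f : Y ⟶ S₁.base.obj A),
      ∃ (A' : C₁) (φ : A' ⟶ A) (e : S₁.base.obj A' ≅ Y), S₁.base.map φ = e.hom ≫ f) :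
    ∃ E' : DivisorMonoidIsoOverBase S₁ S₂ ΨBase,
      ∀ (A : C₁) (x : S₁.Mon (S₁.base.obj A)),
        E'.iso (S₁.base.obj A) x = S₂.pull (η.inv.app A) (E.iso A x) := by
  classical
  -- pointwise form of `η`
  let θ : ∀ B : C₁, S₂.base.obj (Ψ.functor.obj B) ≅ ΨBase.obj (S₁.base.obj B) := fun B => η.app B
  have hc := fun {B B' : C₁} (χ : B ⟶ B') => comp_base_map_eq ΨBase η θ (fun _ => rfl) χ
  have hind : ∀ {A₀ A' : C₁} (g : S₁.base.obj A₀ ≅ S₁.base.obj A') (x : S₁.Mon (S₁.base.obj A')),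
      E.iso A₀ (S₁.pull g.hom x) = S₂.pull (θ A₀ ≪≫ ΨBase.mapIso g ≪≫ (θ A').symm).hom (E.iso A' x) :=
    fun g x => E.iso_pull_iso ΨBase η hconn g x
  -- choices (a): `A X` with `e X : Base (A X) ≅ X`
  choose A hA using hbase
  have e : ∀ X : D₁, S₁.base.obj (A X) ≅ X := fun X => (hA X).some
  -- the comparison isomorphisms `cI X : Ψ^Base X ≅ Base₂ Ψ (A X)`
  let cI : ∀ X : D₁, ΨBase.obj X ≅ S₂.base.obj (Ψ.functor.obj (A X)) := fun X =>
    ΨBase.mapIso (e X).symm ≪≫ (θ (A X)).symm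
  have hcI : ∀ X, (cI X).hom = ΨBase.map (e X).inv ≫ (θ (A X)).inv := fun X => rfl
  -- pull-backs along the isomorphisms `e X`, `cI X` as isomorphisms of monoids
  choose m₁ hm₁ using fun X : D₁ => S₁.exists_pull_mulEquiv (e X)
  choose m₂ hm₂ using fun X : D₁ => S₂.exists_pull_mulEquiv (cI X)
  -- the descended components, and their formula
  let iso : ∀ X : D₁, S₁.Mon X ≃* S₂.Mon (ΨBase.obj X) := fun X =>
    (m₁ X).trans ((E.iso (A X)).trans (m₂ X))
  have hiso : ∀ (X : D₁) (x : S₁.Mon X),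
      iso X x = S₂.pull (cI X).hom (E.iso (A X) (S₁.pull (e X).hom x)) := by
    intro X x
    show m₂ X (E.iso (A X) (m₁ X x)) = _
    rw [hm₂, hm₁]
  refine ⟨⟨iso, fun X Y f x => ?_⟩, fun A₁ x => ?_⟩
  · -- naturality along `f : Y → X`
    rw [hiso, hiso, ← S₁.pull_comp, ← S₂.pull_comp]
    -- (c): `f ≫ (e X)⁻¹ : Y → Base (A X)` is, up to `e' : Base A' ≅ Y`, the base of some `φ : A' → A X`
    obtain ⟨A', φ, e', hφ⟩ := hpb (A X) (f ≫ (e X).inv)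
    -- naturality of `Ψ^Φ` along `φ`
    have h1 := E.natural φ (S₁.pull (e X).hom x)
    rw [← S₁.pull_comp, hφ, Category.assoc, Category.assoc, (e X).inv_hom_id, Category.comp_id] at h1
    -- independence at `A'` versus the chosen `A Y`, along `e' ≫ (e Y)⁻¹`
    have h2 := hind (e' ≪≫ (e Y).symm) (S₁.pull ((e Y).hom ≫ f) x)
    rw [← S₁.pull_comp, Iso.trans_hom, Iso.symm_hom, Category.assoc, (e Y).inv_hom_id_assoc, h1] at h2
    -- solve for `Ψ^Φ_{A Y} ((e Y ≫ f)^* x)`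
    have h3 := S₂.pull_eq_of_pull_eq_of_comp_eq_id _ _ _
      (θ A' ≪≫ ΨBase.mapIso (e' ≪≫ (e Y).symm) ≪≫ (θ (A Y)).symm).inv_hom_id _ _ h2.symm
    have hk : (cI Y).hom ≫ (θ A' ≪≫ ΨBase.mapIso (e' ≪≫ (e Y).symm) ≪≫ (θ (A Y)).symm).inv ≫
        S₂.base.map (Ψ.functor.map φ) = ΨBase.map f ≫ (cI X).hom := by
      rw [hcI, hcI, hc φ, hφ]
      simp only [Iso.trans_inv, Iso.symm_inv, Functor.mapIso_inv, Category.assoc, Iso.inv_hom_id_assoc,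
        Functor.map_comp]
      rw [← ΨBase.map_comp_assoc (e Y).inv (e Y).hom, (e Y).inv_hom_id, ΨBase.map_id, Category.id_comp,
        ← ΨBase.map_comp_assoc e'.inv e'.hom, e'.inv_hom_id, ΨBase.map_id, Category.id_comp]
    rw [h3, ← S₂.pull_comp, hk]
  · -- agreement with `Ψ^Φ_A` at `X = Base A`, transported along `η_A`
    show iso (S₁.base.obj A₁) x = S₂.pull (θ A₁).inv (E.iso A₁ x)
    have hk : (cI (S₁.base.obj A₁)).hom ≫
        (θ (A (S₁.base.obj A₁)) ≪≫ ΨBase.mapIso (e (S₁.base.obj A₁)) ≪≫ (θ A₁).symm).hom = (θ A₁).inv := by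
      rw [hcI]
      simp only [Iso.trans_hom, Iso.symm_hom, Functor.mapIso_hom, Category.assoc, Iso.inv_hom_id_assoc]
      rw [← ΨBase.map_comp_assoc, Iso.inv_hom_id, ΨBase.map_id, Category.id_comp]
    rw [hiso, hind (e (S₁.base.obj A₁)) x, ← S₂.pull_comp, hk]

end DivisorMonoidIsoOver

end TwoFrobenioids

end PreFrobenioidData

end Literature.AlgebraicGeometry.Frobenioids
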